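/-
Copyright (c) 2026 the pub-hodgecm-mathlib formalisation cell (harness21).  Prover seat hodgecm-mathlib-K2-defs1 (g5), Track B ∕ K2-LIT,
h413 = `stmt-HodgeConjecture-24833`, line `K2_E1_TraceFormulaBeta`, campaign «EIS-WHITTAKER-3» WAVE 1, deal D-W3 · J2₃-fin FILE B (dealer K2E1-plan (g5) 2026-09-04T08:16:24Z
«= FILE B after A», (α)(β)): the finite Fourier–Jacobi local integral at a SPLIT place — the affine substitution with its opaque phase, and the two-floor symbol
`S(x,y;u) = max(1,|x|,|u|)·max(1,|y|,|u − xy|)`: support, unit value, holomorphy on `{½ < Re z}`, polynomial bound.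
-/
import Summits.HodgeConjecture.HodgeConjecture.Theorems.K2E1FiniteWhittakerPolynomial    -- ★ p858310: W2-fin closed form ∕ vanishing ∕ unit value (the `|x|,|y| ≤ 1` case)
import Summits.HodgeConjecture.HodgeConjecture.Theorems.K2E1FiniteWhittakerStepSymbol     -- ★ p858371: `integrableOn_stepSymbol_mul_addChar` (continuity bookkeeping of symbol × character)
import Literature.NumberTheory.Automorphic.TateLocalZetaShells                            -- ★ `integral_comp_mul_left`, `integrable_comp_mul_left_iff` (Tate's `d(at) = |a|dt`)
import Literature.NumberTheory.Automorphic.AddCharConductorExponent                       -- ★ `exists_normAbs_eq_inv_zpow`, `HasConductorExp.mulShift`, `mem_primePowBall_iff`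
import Literature.Analysis.Complex.HolomorphicParametricIntegral                          -- ★ `differentiableOn_integral_of_dominated` (holomorphic parameter integrals)
import HarnessLib

/-!
# h413 ∕ Track B «K2-LIT», «EIS-WHITTAKER-3» D-W3 · J2₃-fin FILE B — `K2E1FourierJacobiLocalFiniteSplitU3`: the Fourier–Jacobi local integral at a split place,
# `𝓙 = ∫_F (max(1,|x|,|δt − ½xy|)·max(1,|y|,|δt − ½xy − xy|))^{−z} ψ(ηt) dt` — affine substitution, and the two-floor symbol `S(x,y;u) = max(1,|x|,|u|)·max(1,|y|,|u−xy|)`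

Cell `pub/hodgecm-mathlib`, crux H413 = `stmt-HodgeConjecture-24833`, route `HCCMUnconditional`; dealer K2E1-plan (g5) 08:16:24Z (α)(β) (DEALS memo fe56b7cd5d935977 §D-W3 «split twin»,
CONVENTIONS W0₃ 2fdd2f7063acaab9 §3 «SPLIT»: GL₃ chart `(x, y, u) = (X_w, −X_w̄, tδ_w − ½X_wX_w̄)`, `h_w·h_w̄ = max(1,|x|,|u|)·max(1,|y|,|u − xy|)`).  THEOREMS ONLY (no `def`, no `instance`,
no `notation`, no named-fact hypothesis, no `sorry`; default heartbeats); lane `--kind proof --supports stmt-HodgeConjecture-24833 --as helper` (count-neutral).  ONE local field `F`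
(`[IsNonarchimedeanLocalField F]`, the split place `v`: `L_w = L_w̄ = F_v`), ANY Haar `μ`, `ψ : AddChar F Circle` of conductor exponent `m`, letters of ★ p858310 ∕ ★ p858371 VERBATIM;
the two-floor symbol is ALWAYS spelled out as `max (max 1 ‖x‖) ‖u‖ * max (max 1 ‖y‖) ‖u - x*y‖` (`‖·‖ := ((normAbs F · : ℝ≥0) : ℝ)`), written `S(x,y;u)` in prose, `A := max(1,‖x‖)`, `B := max(1,‖y‖)`.

THE MATHEMATICS (+ two corrections reported on the K2 bus 08:3xZ).  (§1, (α)) `t = δ⁻¹(u + c)`: `∫ f(δt − c) ψ(tη) dt = ‖δ‖⁻¹·ψ(c·δ⁻¹η)·∫ f(u) ψ(u·δ⁻¹η) du` for EVERY `f` (Tate's dilation ★,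
translation invariance, `ψ(a+b) = ψ(a)ψ(b)`); the phase `ψ(c·δ⁻¹η)` (`c = ½xy`) is an OPAQUE unimodular `z`-free constant (J3₃ carries `∏_{v split}` of them).  (§2, generic) If
`g(u + w) = g(u)` for all `w ∈ 𝔭^j` then `∫ gψ(·η′) = ψ(wη′)·∫ gψ(·η′)`, so the integral VANISHES unless `η′ ∈ 𝔭^{m−j}` (★ `HasConductorExp.mulShift`).  (§3) `S ≥ 1`, continuous,
`S(u + w) = S(u)` for `‖w‖ ≤ min(A, B)` (ultrametric), `S(x,y;u) = S(y,x;xy − u)`, **`max(1,‖u‖)² ≤ A·B·S(u)`** (if `‖u‖ > ‖xy‖` then `‖u − xy‖ = ‖u‖`; else `‖u‖ ≤ AB ≤ AB·S`), and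
`S = max(1,‖u‖)²` for `‖x‖, ‖y‖ ≤ 1`.  CORRECTION 1: the invariance radius is `min(A,B)` (at `y = 0`, `‖x‖ = q^r`, `ord η′ = m`: `∫ S^{−z}ψ(η′u) = ‖x‖^{−z}μ(𝒪)(1 − q^{−z}) ≠ 0` although
`‖η′‖·‖x‖ > q^{−m}`).  (§4) SUPPORT from §2 + §3; UNIT VALUE (`‖x‖,‖y‖ ≤ 1`, conductor `𝒪`, `‖η′‖ = 1`): `μ(𝒪)(1 − q^{−2z})` (★ W2-fin (d); the whole `‖x‖,‖y‖ ≤ 1` case IS ★ W2-fin at `η′`).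
(§5) HOLOMORPHY on `{½ < Re z}` (★ dominated-holomorphy engine, majorant `(AB)^{σ₁}·max(1,‖u‖)^{−2σ₀}` on the disc of radius `(Re z₀ − ½)∕2`) — NOT claimed ENTIRE: `S` is not a radial step
symbol when `‖xy‖ > max(A,B)` (on the sphere `‖u‖ = ‖xy‖` it depends on `‖u − xy‖`), so ★ StepSymbol does not apply verbatim (a two-centre shell sum; FILE B2 if ruled load-bearing — the
window needs `{½ < Re}` only).  (§6) `‖∫ S^{−z}ψ‖ ≤ (AB)^{Re z}·∫ max(1,‖u‖)^{−2Re z} dμ` (`Re z > ½`), POLYNOMIAL in the floors; CORRECTION 2: no bound uniform in `(x,y)` on `½ < Re z < 1`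
(`≍ (AB)^{1−Re z}` from the sphere `‖u − xy‖ < ‖xy‖`).

* §1 **`integral_comp_affine_mul_addChar`** (every `f`), `integrable_comp_affine_mul_addChar_iff`.
* §2 **`integral_mul_addChar_eq_mul_of_forall_add_eq`**, `exists_mem_primePowBall_addChar_ne_one`, **`integral_mul_addChar_eq_zero_of_forall_add_eq`** (generic support lemma).
* §3 `one_le_twoFloor`, `continuous_twoFloor`, `twoFloor_swap`, `max_le_of_normAbs_le` ∕ **`twoFloor_add_of_normAbs_le`** (invariance), **`max_one_sq_le_mul_twoFloor`**, **`twoFloor_eq_sq_of_le_one`**.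
* §4 **`integral_twoFloor_mul_addChar_eq_zero_of_not_mem`** (SUPPORT), **`integral_twoFloor_mul_addChar_eq_of_le_one`** (= ★ W2-fin at `η′`), **`…_eq_of_le_one_of_normAbs_eq_one`** (UNIT VALUE).
* §5 `integrable_twoFloor_mul_addChar`, **`differentiableOn_integral_twoFloor_mul_addChar`** (`{½ < Re z}`).   §6 **`norm_integral_twoFloor_mul_addChar_le`**.
HONEST LABEL.  Count-neutral helper; proves no printed statement; HC_CM is proved only modulo the 7 printed citations (2 remaining named inputs: hLiu418 =
`stmt-HodgeConjecture-24832`, h413 = `stmt-HodgeConjecture-24833`) until rung 0 closes.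

## References
* [GelbartPiatetskiShapiro1984] S. Gelbart, I. Piatetski-Shapiro, *Automorphic forms and L-functions for the unitary group*, LNM 1041 (1984), §4 (4.5).  [Tate1950] J. Tate, thesis, §2.2
  Lemma 2.2.5, §2.5 (in [CasselsFrohlichANT1967] Ch. XV).  [Casselman1980] W. Casselman, *The unramified principal series of p-adic groups I*, Compositio Math. 40 (1980), §3.
-/

set_option autoImplicit false
set_option linter.dupNamespace false  -- the mandated namespace repeats the summit's segment (`HodgeConjecture.HodgeConjecture`)

noncomputable section
open MeasureTheory Filter Topology Set Metric
open scoped NNReal ENNReal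
open Literature.NumberTheory.GaloisRepresentations.IsNonarchimedeanLocalField
open Literature.NumberTheory.Automorphic Literature.NumberTheory.Automorphic.LocalFieldHaar
open Summit.HodgeConjecture.HodgeConjecture.Cruxes.H413.K2E1FiniteWhittakerPolynomial
open Summit.HodgeConjecture.HodgeConjecture.Cruxes.H413.K2E1FiniteWhittakerStepSymbol
open Summit.HodgeConjecture.HodgeConjecture.Cruxes.H413.K2E1IntertwiningLocalFactorU2 (integrable_max_one_normAbs_rpow_neg)
namespace Summit.HodgeConjecture.HodgeConjecture.Cruxes.H413.K2E1FourierJacobiLocalFiniteSplitU3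

variable {F : Type*} [Field F] [ValuativeRel F] [TopologicalSpace F] [IsNonarchimedeanLocalField F]

section Haar
variable [MeasurableSpace F] [BorelSpace F] (μ : Measure F) [μ.IsAddHaarMeasure]

/-! ## §1 (α) The affine substitution `u = δt − c` and its opaque phase -/

/-- **THE AFFINE SUBSTITUTION WITH A CHARACTER**: for `δ ≠ 0`, any `c, η ∈ F` and EVERY `f : F → ℂ`,
`∫ f(δt − c)·ψ(tη) dμ(t) = ‖δ⁻¹‖ · ψ(c·δ⁻¹η) · ∫ f(u)·ψ(u·δ⁻¹η) dμ(u)` (`t = δ⁻¹(u + c)`: Tate's dilation ★ `integral_comp_mul_left`, translation invariance, `ψ(a+b) = ψ(a)ψ(b)`).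
The phase `ψ(c·δ⁻¹η)` is a unimodular constant independent of `f` (and of any spectral parameter in `f`). [cite: Tate1950, §2.2, Lemma 2.2.5] [cite: GelbartPiatetskiShapiro1984, §4 (4.5)] -/
theorem integral_comp_affine_mul_addChar (ψ : AddChar F Circle) {δ : F} (hδ : δ ≠ 0) (c η : F) (f : F → ℂ) :
    ∫ t, f (δ * t - c) * ((ψ (t * η) : Circle) : ℂ) ∂μ =
      (((normAbs F δ⁻¹ : ℝ≥0) : ℝ) : ℂ) * ((ψ (c * (δ⁻¹ * η)) : Circle) : ℂ) * ∫ u, f u * ((ψ (u * (δ⁻¹ * η)) : Circle) : ℂ) ∂μ := by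
  have hsub := integral_comp_mul_left μ hδ (fun u' : F => f (u' - c) * ((ψ (δ⁻¹ * u' * η) : Circle) : ℂ))
  have h1 : (fun t : F => f (δ * t - c) * ((ψ (t * η) : Circle) : ℂ)) = fun t => (fun u' : F => f (u' - c) * ((ψ (δ⁻¹ * u' * η) : Circle) : ℂ)) (δ * t) := by
    funext t
    simp only [inv_mul_cancel_left₀ hδ]
  rw [h1, hsub]
  have h2 : ∫ u', f (u' - c) * ((ψ (δ⁻¹ * u' * η) : Circle) : ℂ) ∂μ = ∫ u, f u * ((ψ (δ⁻¹ * (u + c) * η) : Circle) : ℂ) ∂μ := by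
    rw [← integral_add_right_eq_self (μ := μ) (fun u' => f (u' - c) * ((ψ (δ⁻¹ * u' * η) : Circle) : ℂ)) c]
    simp only [add_sub_cancel_right]
  rw [h2]
  have h3 : (fun u : F => f u * ((ψ (δ⁻¹ * (u + c) * η) : Circle) : ℂ)) = fun u => ((ψ (c * (δ⁻¹ * η)) : Circle) : ℂ) * (f u * ((ψ (u * (δ⁻¹ * η)) : Circle) : ℂ)) := by
    funext u
    rw [show δ⁻¹ * (u + c) * η = u * (δ⁻¹ * η) + c * (δ⁻¹ * η) by ring, AddChar.map_add_eq_mul, Circle.coe_mul]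
    ring
  rw [h3, integral_const_mul, Complex.real_smul, mul_assoc]

/-- Integrability is preserved by the affine substitution (`δ ≠ 0`). [cite: Tate1950, §2.2] -/
theorem integrable_comp_affine_mul_addChar_iff (ψ : AddChar F Circle) {δ : F} (hδ : δ ≠ 0) (c η : F) (f : F → ℂ) :
    Integrable (fun t => f (δ * t - c) * ((ψ (t * η) : Circle) : ℂ)) μ ↔ Integrable (fun u => f u * ((ψ (u * (δ⁻¹ * η)) : Circle) : ℂ)) μ := by
  have key := Literature.NumberTheory.Automorphic.integrable_comp_mul_left_iff μ hδ
    (fun u' : F => f (u' - c) * ((ψ (δ⁻¹ * u' * η) : Circle) : ℂ))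
  have h1 : (fun t : F => f (δ * t - c) * ((ψ (t * η) : Circle) : ℂ)) = fun t => (fun u' : F => f (u' - c) * ((ψ (δ⁻¹ * u' * η) : Circle) : ℂ)) (δ * t) := by
    funext t
    simp only [inv_mul_cancel_left₀ hδ]
  rw [h1]
  refine key.trans ?_
  have h3 : (fun u' : F => f (u' - c) * ((ψ (δ⁻¹ * u' * η) : Circle) : ℂ)) =
      fun u' => ((ψ (c * (δ⁻¹ * η)) : Circle) : ℂ) * (fun u => f u * ((ψ (u * (δ⁻¹ * η)) : Circle) : ℂ)) (u' - c) := by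
    funext u'
    simp only
    rw [show δ⁻¹ * u' * η = (u' - c) * (δ⁻¹ * η) + c * (δ⁻¹ * η) by ring, AddChar.map_add_eq_mul, Circle.coe_mul]
    ring
  rw [h3, integrable_const_mul_iff (Circle.coe_ne_zero _).isUnit]
  constructor
  · intro h
    have h' := h.comp_sub_right (-c)
    simp only [sub_neg_eq_add, add_sub_cancel_right] at h'
    exact h'
  · intro h
    exact h.comp_sub_right c

/-! ## §2 A generic support lemma: periodic symbols see only frequencies trivial on the period ball -/

omit [MeasurableSpace F] [BorelSpace F] in
/-- If `η′ ∉ 𝔭^{m−j}` then `ψ(η′·)` is NOT trivial on `𝔭^j`: `∃ w ∈ 𝔭^j, ψ(w η′) ≠ 1` (`ψ(η′·)` has conductor exponent `m − ord η′`, ★ `HasConductorExp.mulShift`). [cite: Tate1950, §2.2] -/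
theorem exists_mem_primePowBall_addChar_ne_one {ψ : AddChar F Circle} {m : ℤ} (hm : ψ.HasConductorExp m) (j : ℤ) {η' : F} (hη : η' ∉ primePowBall F (m - j)) :
    ∃ w ∈ primePowBall F j, ψ (w * η') ≠ 1 := by
  have hη0 : η' ≠ 0 := fun h => hη (h ▸ zero_mem_primePowBall _)
  obtain ⟨k, hk⟩ := exists_normAbs_eq_inv_zpow hη0
  have hcond := hm.mulShift hk   -- `ψ(η'·)` has conductor exponent `m - k`
  obtain ⟨w, hw, hw1⟩ := hcond.2
  refine ⟨w, primePowBall_antitone ?_ hw, by rwa [AddChar.mulShift_apply, mul_comm] at hw1⟩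
  have hlt : ¬ (m - j ≤ k) := by
    intro hle
    apply hη
    rw [mem_primePowBall_iff, hk]
    exact zpow_le_zpow_right_of_le_one₀ inv_residueFieldCard_pos inv_residueFieldCard_lt_one.le hle
  omega

/-- **PERIODICITY FORCES A PHASE**: if `g(u + w) = g(u)` for all `u` (a fixed `w`), then `∫ g(u)ψ(uη′) dμ(u) = ψ(wη′) · ∫ g(u)ψ(uη′) dμ(u)` (translate `u ↦ u + w`; every `g`,
no integrability needed). [cite: Tate1950, §2.2] -/
theorem integral_mul_addChar_eq_mul_of_forall_add_eq (ψ : AddChar F Circle) {g : F → ℂ} {w : F} (hg : ∀ u, g (u + w) = g u) (η' : F) :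
    ∫ u, g u * ((ψ (u * η') : Circle) : ℂ) ∂μ = ((ψ (w * η') : Circle) : ℂ) * ∫ u, g u * ((ψ (u * η') : Circle) : ℂ) ∂μ := by
  have h := integral_add_right_eq_self (μ := μ) (fun u => g u * ((ψ (u * η') : Circle) : ℂ)) w
  simp only [hg] at h
  calc ∫ u, g u * ((ψ (u * η') : Circle) : ℂ) ∂μ = ∫ u, g u * ((ψ ((u + w) * η') : Circle) : ℂ) ∂μ := h.symm
    _ = ∫ u, ((ψ (w * η') : Circle) : ℂ) * (g u * ((ψ (u * η') : Circle) : ℂ)) ∂μ := by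
        refine integral_congr_ae (Eventually.of_forall fun u => ?_)
        simp only
        rw [show (u + w) * η' = u * η' + w * η' by ring, AddChar.map_add_eq_mul, Circle.coe_mul]
        ring
    _ = ((ψ (w * η') : Circle) : ℂ) * ∫ u, g u * ((ψ (u * η') : Circle) : ℂ) ∂μ := integral_const_mul _ _

/-- **THE GENERIC SUPPORT LEMMA**: if `g(u + w) = g(u)` for all `u` and all `w ∈ 𝔭^j`, and `η′ ∉ 𝔭^{m−j}` (`m` the conductor exponent of `ψ`), then `∫ g(u)ψ(uη′) dμ(u) = 0`
(the phase `ψ(wη′) ≠ 1` of §2 forces it; every `g`, no integrability needed). [cite: Tate1950, §2.2, §2.5] -/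
theorem integral_mul_addChar_eq_zero_of_forall_add_eq {ψ : AddChar F Circle} {m : ℤ} (hm : ψ.HasConductorExp m) {j : ℤ} {g : F → ℂ}
    (hg : ∀ u, ∀ w ∈ primePowBall F j, g (u + w) = g u) {η' : F} (hη : η' ∉ primePowBall F (m - j)) :
    ∫ u, g u * ((ψ (u * η') : Circle) : ℂ) ∂μ = 0 := by
  obtain ⟨w, hw, hw1⟩ := exists_mem_primePowBall_addChar_ne_one hm j hη
  have h := integral_mul_addChar_eq_mul_of_forall_add_eq μ ψ (fun u => hg u w hw) η'
  have hne : ((ψ (w * η') : Circle) : ℂ) ≠ 1 := fun h1 => hw1 (Circle.coe_eq_one.mp h1)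
  have h2 : (1 - ((ψ (w * η') : Circle) : ℂ)) * ∫ u, g u * ((ψ (u * η') : Circle) : ℂ) ∂μ = 0 := by
    rw [sub_mul, one_mul, ← h, sub_self]
  exact (mul_eq_zero.mp h2).resolve_left (sub_ne_zero.mpr (Ne.symm hne))

end Haar

/-! ## §3 The two-floor symbol `S(x,y;u) = max(1,‖x‖,‖u‖)·max(1,‖y‖,‖u − xy‖)` -/

/-- `S ≥ 1`. [folklore] -/
theorem one_le_twoFloor (x y u : F) :
    (1 : ℝ) ≤ max (max 1 ((normAbs F x : ℝ≥0) : ℝ)) ((normAbs F u : ℝ≥0) : ℝ) * max (max 1 ((normAbs F y : ℝ≥0) : ℝ)) ((normAbs F (u - x * y) : ℝ≥0) : ℝ) :=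
  one_le_mul_of_one_le_of_one_le (le_max_of_le_left (le_max_left _ _)) (le_max_of_le_left (le_max_left _ _))

/-- `S` is continuous in `u`. [folklore] -/
theorem continuous_twoFloor (x y : F) :
    Continuous fun u : F => max (max 1 ((normAbs F x : ℝ≥0) : ℝ)) ((normAbs F u : ℝ≥0) : ℝ) * max (max 1 ((normAbs F y : ℝ≥0) : ℝ)) ((normAbs F (u - x * y) : ℝ≥0) : ℝ) := by
  have hc : Continuous fun u : F => ((normAbs F u : ℝ≥0) : ℝ) := NNReal.continuous_coe.comp continuous_normAbs
  exact (continuous_const.max hc).mul (continuous_const.max (hc.comp (continuous_id.sub continuous_const)))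

/-- The symmetry `S(x,y;u) = S(y,x; xy − u)` (swap the floors; `‖xy − u − yx‖ = ‖u‖`). [folklore] -/
theorem twoFloor_swap (x y u : F) :
    max (max 1 ((normAbs F x : ℝ≥0) : ℝ)) ((normAbs F u : ℝ≥0) : ℝ) * max (max 1 ((normAbs F y : ℝ≥0) : ℝ)) ((normAbs F (u - x * y) : ℝ≥0) : ℝ) =
      max (max 1 ((normAbs F y : ℝ≥0) : ℝ)) ((normAbs F (x * y - u) : ℝ≥0) : ℝ) * max (max 1 ((normAbs F x : ℝ≥0) : ℝ)) ((normAbs F (x * y - u - y * x) : ℝ≥0) : ℝ) := by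
  rw [show x * y - u - y * x = -u by ring, normAbs_neg, show x * y - u = -(u - x * y) by ring, normAbs_neg, mul_comm]

/-- ONE FLOOR ABSORBS SMALL TRANSLATIONS (ultrametric): `max(R, ‖u + w‖) = max(R, ‖u‖)` whenever `‖w‖ ≤ R`. [folklore] -/
theorem max_normAbs_add_eq_of_le {R : ℝ} {w : F} (hw : ((normAbs F w : ℝ≥0) : ℝ) ≤ R) (u : F) :
    max R ((normAbs F (u + w) : ℝ≥0) : ℝ) = max R ((normAbs F u : ℝ≥0) : ℝ) := by
  have hum : ((normAbs F (u + w) : ℝ≥0) : ℝ) ≤ max ((normAbs F u : ℝ≥0) : ℝ) ((normAbs F w : ℝ≥0) : ℝ) := by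
    exact_mod_cast normAbs_add_le_max u w
  apply le_antisymm
  · refine max_le (le_max_left _ _) (hum.trans (max_le (le_max_right _ _) (hw.trans (le_max_left _ _))))
  · refine max_le (le_max_left _ _) ?_
    have hum' : ((normAbs F u : ℝ≥0) : ℝ) ≤ max ((normAbs F (u + w) : ℝ≥0) : ℝ) ((normAbs F w : ℝ≥0) : ℝ) := by
      have h := normAbs_add_le_max (u + w) (-w)
      rw [add_neg_cancel_right, normAbs_neg] at h
      exact_mod_cast h
    exact hum'.trans (max_le (le_max_right _ _) (hw.trans (le_max_left _ _)))

/-- **THE SYMBOL IS PERIODIC UNDER THE SMALLER FLOOR**: `S(x,y;u + w) = S(x,y;u)` for `‖w‖ ≤ min(max(1,‖x‖), max(1,‖y‖))`. [folklore] -/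
theorem twoFloor_add_of_normAbs_le (x y : F) {w : F}
    (hwx : ((normAbs F w : ℝ≥0) : ℝ) ≤ max 1 ((normAbs F x : ℝ≥0) : ℝ)) (hwy : ((normAbs F w : ℝ≥0) : ℝ) ≤ max 1 ((normAbs F y : ℝ≥0) : ℝ)) (u : F) :
    max (max 1 ((normAbs F x : ℝ≥0) : ℝ)) ((normAbs F (u + w) : ℝ≥0) : ℝ) * max (max 1 ((normAbs F y : ℝ≥0) : ℝ)) ((normAbs F (u + w - x * y) : ℝ≥0) : ℝ) =
      max (max 1 ((normAbs F x : ℝ≥0) : ℝ)) ((normAbs F u : ℝ≥0) : ℝ) * max (max 1 ((normAbs F y : ℝ≥0) : ℝ)) ((normAbs F (u - x * y) : ℝ≥0) : ℝ) := by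
  rw [max_normAbs_add_eq_of_le hwx, show u + w - x * y = (u - x * y) + w by ring, max_normAbs_add_eq_of_le hwy]

/-- **THE DOMINATION `max(1,‖u‖)² ≤ A·B·S(u)`** (`A = max(1,‖x‖)`, `B = max(1,‖y‖)`): if `‖u‖ > ‖xy‖` then `‖u − xy‖ = ‖u‖` and `S ≥ max(1,‖u‖)²`; otherwise `max(1,‖u‖) ≤ AB ≤ A·B·S`.
[folklore] -/
theorem max_one_sq_le_mul_twoFloor (x y u : F) :
    (max 1 ((normAbs F u : ℝ≥0) : ℝ)) ^ 2 ≤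
      (max 1 ((normAbs F x : ℝ≥0) : ℝ) * max 1 ((normAbs F y : ℝ≥0) : ℝ)) *
        (max (max 1 ((normAbs F x : ℝ≥0) : ℝ)) ((normAbs F u : ℝ≥0) : ℝ) * max (max 1 ((normAbs F y : ℝ≥0) : ℝ)) ((normAbs F (u - x * y) : ℝ≥0) : ℝ)) := by
  set A : ℝ := max 1 ((normAbs F x : ℝ≥0) : ℝ) with hA
  set B : ℝ := max 1 ((normAbs F y : ℝ≥0) : ℝ) with hB
  set U : ℝ := ((normAbs F u : ℝ≥0) : ℝ) with hU
  have hA1 : 1 ≤ A := le_max_left _ _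
  have hB1 : 1 ≤ B := le_max_left _ _
  have hU0 : 0 ≤ U := NNReal.coe_nonneg _
  have hS1 : A ≤ max A U := le_max_left _ _
  have hS2 : B ≤ max B ((normAbs F (u - x * y) : ℝ≥0) : ℝ) := le_max_left _ _
  have hxy : ((normAbs F (x * y) : ℝ≥0) : ℝ) ≤ A * B := by
    rw [map_mul, NNReal.coe_mul]
    exact mul_le_mul (le_max_right _ _) (le_max_right _ _) (NNReal.coe_nonneg _) (zero_le_one.trans hA1)
  by_cases hu : ((normAbs F (x * y) : ℝ≥0) : ℝ) < U
  · have heq : ((normAbs F (u - x * y) : ℝ≥0) : ℝ) = U := by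
      have h := normAbs_add_eq_of_lt (a := u) (t := -(x * y)) (by rw [normAbs_neg]; exact_mod_cast hu)
      rw [← sub_eq_add_neg] at h
      rw [hU, h]
    rw [heq]
    calc (max 1 U) ^ 2 = max 1 U * max 1 U := sq _
      _ ≤ max A U * max B U := mul_le_mul (max_le_max hA1 le_rfl) (max_le_max hB1 le_rfl) (by positivity) (by positivity)
      _ ≤ (A * B) * (max A U * max B U) := le_mul_of_one_le_left (by positivity) (one_le_mul_of_one_le_of_one_le hA1 hB1)
  · have hU' : max 1 U ≤ A * B := max_le (one_le_mul_of_one_le_of_one_le hA1 hB1) ((not_lt.mp hu).trans hxy)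
    calc (max 1 U) ^ 2 = max 1 U * max 1 U := sq _
      _ ≤ (A * B) * (A * B) := mul_le_mul hU' hU' (by positivity) (by positivity)
      _ ≤ (A * B) * (max A U * max B ((normAbs F (u - x * y) : ℝ≥0) : ℝ)) := by gcongr

/-- **ON INTEGRAL `x, y` THE SYMBOL IS THE SQUARED RANK-ONE WEIGHT**: `‖x‖, ‖y‖ ≤ 1 ⟹ S(x,y;u) = max(1,‖u‖)²` (both floors equal `max(1,‖u‖)`: `‖xy‖ ≤ 1`). [folklore] -/
theorem twoFloor_eq_sq_of_le_one {x y : F} (hx : ((normAbs F x : ℝ≥0) : ℝ) ≤ 1) (hy : ((normAbs F y : ℝ≥0) : ℝ) ≤ 1) (u : F) :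
    max (max 1 ((normAbs F x : ℝ≥0) : ℝ)) ((normAbs F u : ℝ≥0) : ℝ) * max (max 1 ((normAbs F y : ℝ≥0) : ℝ)) ((normAbs F (u - x * y) : ℝ≥0) : ℝ) =
      (max 1 ((normAbs F u : ℝ≥0) : ℝ)) ^ 2 := by
  have hxy : ((normAbs F (-(x * y)) : ℝ≥0) : ℝ) ≤ 1 := by
    rw [normAbs_neg, map_mul, NNReal.coe_mul]
    exact mul_le_one₀ hx (NNReal.coe_nonneg _) hy
  rw [max_eq_left hx, max_eq_left hy, sub_eq_add_neg, max_normAbs_add_eq_of_le hxy, sq]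

/-- **THE POINTWISE DOMINATION** `S(u)^{−σ} ≤ (A·B)^{σ}·max(1,‖u‖)^{−2σ}` for `σ ≥ 0` (from `max(1,‖u‖)² ≤ A·B·S(u)`; `A = max(1,‖x‖)`, `B = max(1,‖y‖)`). [folklore] -/
theorem twoFloor_rpow_neg_le (x y u : F) {σ : ℝ} (hσ : 0 ≤ σ) :
    (max (max 1 ((normAbs F x : ℝ≥0) : ℝ)) ((normAbs F u : ℝ≥0) : ℝ) * max (max 1 ((normAbs F y : ℝ≥0) : ℝ)) ((normAbs F (u - x * y) : ℝ≥0) : ℝ)) ^ (-σ) ≤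
      (max 1 ((normAbs F x : ℝ≥0) : ℝ) * max 1 ((normAbs F y : ℝ≥0) : ℝ)) ^ σ * (max 1 ((normAbs F u : ℝ≥0) : ℝ)) ^ (-(2 * σ)) := by
  set S : ℝ := max (max 1 ((normAbs F x : ℝ≥0) : ℝ)) ((normAbs F u : ℝ≥0) : ℝ) * max (max 1 ((normAbs F y : ℝ≥0) : ℝ)) ((normAbs F (u - x * y) : ℝ≥0) : ℝ) with hS
  set AB : ℝ := max 1 ((normAbs F x : ℝ≥0) : ℝ) * max 1 ((normAbs F y : ℝ≥0) : ℝ) with hAB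
  set M : ℝ := max 1 ((normAbs F u : ℝ≥0) : ℝ) with hM
  have hS0 : 0 < S := one_pos.trans_le (one_le_twoFloor x y u)
  have hAB0 : 0 < AB := one_pos.trans_le (one_le_mul_of_one_le_of_one_le (le_max_left _ _) (le_max_left _ _))
  have hM0 : 0 < M := one_pos.trans_le (le_max_left _ _)
  have hdom : M ^ 2 ≤ AB * S := max_one_sq_le_mul_twoFloor x y u
  have key : S⁻¹ ≤ AB / M ^ 2 := by
    rw [inv_eq_one_div, div_le_div_iff₀ hS0 (by positivity), one_mul]
    exact hdom
  calc S ^ (-σ) = (S⁻¹) ^ σ := by rw [Real.inv_rpow hS0.le, Real.rpow_neg hS0.le]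
    _ ≤ (AB / M ^ 2) ^ σ := Real.rpow_le_rpow (inv_nonneg.mpr hS0.le) key hσ
    _ = AB ^ σ * (M ^ 2)⁻¹ ^ σ := by rw [div_eq_mul_inv, Real.mul_rpow hAB0.le (by positivity)]
    _ = AB ^ σ * M ^ (-(2 * σ)) := by
        congr 1
        rw [Real.inv_rpow (by positivity), Real.rpow_neg hM0.le, show (2 : ℝ) * σ = ((2 : ℕ) : ℝ) * σ by norm_num, Real.rpow_natCast_mul hM0.le]

section Integrals
variable [MeasurableSpace F] [BorelSpace F] (μ : Measure F) [μ.IsAddHaarMeasure]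

/-! ## §4 Support and the integral (`‖x‖, ‖y‖ ≤ 1`) value of `I(z, η′) = ∫ S(x,y;u)^{−z} ψ(uη′) dμ(u)` -/

/-- **SUPPORT**: if `𝔭^j` lies inside BOTH floors (`‖w‖ ≤ max(1,‖x‖)` and `‖w‖ ≤ max(1,‖y‖)` for `w ∈ 𝔭^j`) and `η′ ∉ 𝔭^{m−j}`, then `∫ S(x,y;u)^{−z} ψ(uη′) dμ(u) = 0` for EVERY `z`
(§2 + §3: the symbol is `𝔭^j`-periodic).  At `j = 0` this is the conductor support `η′ ∈ 𝔭^m` (next lemma). [cite: GelbartPiatetskiShapiro1984, §4 (4.5)] [cite: Tate1950, §2.5] -/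
theorem integral_twoFloor_mul_addChar_eq_zero_of_not_mem {ψ : AddChar F Circle} {m : ℤ} (hm : ψ.HasConductorExp m) (x y : F) {j : ℤ}
    (hjx : ∀ w ∈ primePowBall F j, ((normAbs F w : ℝ≥0) : ℝ) ≤ max 1 ((normAbs F x : ℝ≥0) : ℝ))
    (hjy : ∀ w ∈ primePowBall F j, ((normAbs F w : ℝ≥0) : ℝ) ≤ max 1 ((normAbs F y : ℝ≥0) : ℝ))
    {η' : F} (hη : η' ∉ primePowBall F (m - j)) (z : ℂ) :
    ∫ u, ((max (max 1 ((normAbs F x : ℝ≥0) : ℝ)) ((normAbs F u : ℝ≥0) : ℝ) * max (max 1 ((normAbs F y : ℝ≥0) : ℝ)) ((normAbs F (u - x * y) : ℝ≥0) : ℝ) : ℝ) : ℂ) ^ (-z) *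
      ((ψ (u * η') : Circle) : ℂ) ∂μ = 0 :=
  integral_mul_addChar_eq_zero_of_forall_add_eq μ hm (fun u w hw => by rw [twoFloor_add_of_normAbs_le x y (hjx w hw) (hjy w hw)]) hη

/-- **CONDUCTOR SUPPORT** (the case `j = 0`, always available since both floors are `≥ 1`): `η′ ∉ 𝔭^m ⟹ ∫ S(x,y;u)^{−z} ψ(uη′) dμ = 0`. [cite: Tate1950, §2.5] -/
theorem integral_twoFloor_mul_addChar_eq_zero_of_not_mem_conductor {ψ : AddChar F Circle} {m : ℤ} (hm : ψ.HasConductorExp m) (x y : F)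
    {η' : F} (hη : η' ∉ primePowBall F m) (z : ℂ) :
    ∫ u, ((max (max 1 ((normAbs F x : ℝ≥0) : ℝ)) ((normAbs F u : ℝ≥0) : ℝ) * max (max 1 ((normAbs F y : ℝ≥0) : ℝ)) ((normAbs F (u - x * y) : ℝ≥0) : ℝ) : ℝ) : ℂ) ^ (-z) *
      ((ψ (u * η') : Circle) : ℂ) ∂μ = 0 := by
  have h0 : ∀ w ∈ primePowBall F (0 : ℤ), ((normAbs F w : ℝ≥0) : ℝ) ≤ 1 := fun w hw => by
    have h := mem_primePowBall_iff.mp hw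
    rw [zpow_zero] at h
    exact_mod_cast h
  exact integral_twoFloor_mul_addChar_eq_zero_of_not_mem μ hm x y (j := 0) (fun w hw => (h0 w hw).trans (le_max_left _ _))
    (fun w hw => (h0 w hw).trans (le_max_left _ _)) (by rwa [sub_zero]) z

omit [BorelSpace F] [μ.IsAddHaarMeasure] in
/-- **ON INTEGRAL `x, y` THE SPLIT FJ INTEGRAL IS ★ W2-fin's** (`‖x‖, ‖y‖ ≤ 1`): `∫ S(x,y;u)^{−z} ψ(uη′) dμ = ∫ max(1,‖u‖)^{−2z} ψ(uη′) dμ` for EVERY `z`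
(`S = max(1,‖u‖)²`, `(m·m)^{−z} = m^{−z}·m^{−z} = m^{−2z}`) — so its closed form ∕ support ∕ unit value are ★ p858310 BY NAME at the frequency `η′`. [cite: Casselman1980, §3] -/
theorem integral_twoFloor_mul_addChar_eq_of_le_one {x y : F} (hx : ((normAbs F x : ℝ≥0) : ℝ) ≤ 1) (hy : ((normAbs F y : ℝ≥0) : ℝ) ≤ 1) (ψ : AddChar F Circle) (η' : F) (z : ℂ) :
    ∫ u, ((max (max 1 ((normAbs F x : ℝ≥0) : ℝ)) ((normAbs F u : ℝ≥0) : ℝ) * max (max 1 ((normAbs F y : ℝ≥0) : ℝ)) ((normAbs F (u - x * y) : ℝ≥0) : ℝ) : ℝ) : ℂ) ^ (-z) *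
        ((ψ (u * η') : Circle) : ℂ) ∂μ =
      ∫ u, (((max 1 ((normAbs F u : ℝ≥0) : ℝ) : ℝ) : ℂ) ^ (-(2 * z))) * ((ψ (u * η') : Circle) : ℂ) ∂μ := by
  refine integral_congr_ae (Eventually.of_forall fun u => ?_)
  have hm0 : (0 : ℝ) ≤ max 1 ((normAbs F u : ℝ≥0) : ℝ) := zero_le_one.trans (le_max_left _ _)
  have hmC : ((max 1 ((normAbs F u : ℝ≥0) : ℝ) : ℝ) : ℂ) ≠ 0 := by exact_mod_cast (one_pos.trans_le (le_max_left 1 ((normAbs F u : ℝ≥0) : ℝ))).ne'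
  dsimp only
  rw [twoFloor_eq_sq_of_le_one hx hy, sq, Complex.ofReal_mul, Complex.mul_cpow_ofReal_nonneg hm0 hm0, show -(2 * z) = -z + -z by ring,
    Complex.cpow_add _ _ hmC]

/-- **THE UNRAMIFIED SPLIT FJ FACTOR** (`‖x‖, ‖y‖ ≤ 1`, conductor `𝒪`, `‖η′‖ = 1`, `Re z > ½`): `∫ S(x,y;u)^{−z} ψ(uη′) dμ = μ(𝒪)·(1 − q^{−2z})` — the same local factor of `ζ^{S}_{L⁺}(2z)⁻¹`
as at an inert place (★ W2-fin (d)). [cite: GelbartPiatetskiShapiro1984, §4 (4.5)] [cite: Casselman1980, §3] -/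
theorem integral_twoFloor_mul_addChar_eq_of_le_one_of_normAbs_eq_one {x y : F} (hx : ((normAbs F x : ℝ≥0) : ℝ) ≤ 1) (hy : ((normAbs F y : ℝ≥0) : ℝ) ≤ 1)
    {ψ : AddChar F Circle} (hψ : Continuous ψ) (h0 : ψ.HasConductorExp 0) {η' : F} (hη : normAbs F η' = 1) {z : ℂ} (hz : 1 / 2 < z.re) :
    ∫ u, ((max (max 1 ((normAbs F x : ℝ≥0) : ℝ)) ((normAbs F u : ℝ≥0) : ℝ) * max (max 1 ((normAbs F y : ℝ≥0) : ℝ)) ((normAbs F (u - x * y) : ℝ≥0) : ℝ) : ℝ) : ℂ) ^ (-z) *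
        ((ψ (u * η') : Circle) : ℂ) ∂μ =
      (μ.real (primePowBall F 0) : ℂ) * (1 - (residueFieldCard F : ℂ) ^ (-(2 * z))) := by
  rw [integral_twoFloor_mul_addChar_eq_of_le_one μ hx hy ψ η' z, integral_weight_mul_addChar_eq_of_conductor_zero_of_normAbs_eq_one μ hψ h0 hη hz]

/-! ## §5 Integrability and holomorphy on `{½ < Re z}` -/

omit [MeasurableSpace F] [BorelSpace F] in
/-- The integrand `S(x,y;u)^{−z}·ψ(uη′)` is continuous in `u`. [folklore] -/
theorem continuous_twoFloor_cpow_mul_addChar {ψ : AddChar F Circle} (hψ : Continuous ψ) (x y η' : F) (z : ℂ) :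
    Continuous fun u : F =>
      ((max (max 1 ((normAbs F x : ℝ≥0) : ℝ)) ((normAbs F u : ℝ≥0) : ℝ) * max (max 1 ((normAbs F y : ℝ≥0) : ℝ)) ((normAbs F (u - x * y) : ℝ≥0) : ℝ) : ℝ) : ℂ) ^ (-z) *
        ((ψ (u * η') : Circle) : ℂ) := by
  refine Continuous.mul ?_ (continuous_subtype_val.comp (hψ.comp (continuous_id.mul continuous_const)))
  exact (Complex.continuous_ofReal.comp (continuous_twoFloor x y)).cpow continuous_const
    fun u => Complex.ofReal_mem_slitPlane.mpr (one_pos.trans_le (one_le_twoFloor x y u))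

omit [MeasurableSpace F] [BorelSpace F] in
/-- The norm of the integrand: `‖S(u)^{−z}·ψ(uη′)‖ = S(u)^{−Re z}`. [folklore] -/
theorem norm_twoFloor_cpow_mul_addChar (ψ : AddChar F Circle) (x y η' u : F) (z : ℂ) :
    ‖((max (max 1 ((normAbs F x : ℝ≥0) : ℝ)) ((normAbs F u : ℝ≥0) : ℝ) * max (max 1 ((normAbs F y : ℝ≥0) : ℝ)) ((normAbs F (u - x * y) : ℝ≥0) : ℝ) : ℝ) : ℂ) ^ (-z) *
        ((ψ (u * η') : Circle) : ℂ)‖ =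
      (max (max 1 ((normAbs F x : ℝ≥0) : ℝ)) ((normAbs F u : ℝ≥0) : ℝ) * max (max 1 ((normAbs F y : ℝ≥0) : ℝ)) ((normAbs F (u - x * y) : ℝ≥0) : ℝ)) ^ (-z.re) := by
  rw [norm_mul, Circle.norm_coe, mul_one, Complex.norm_cpow_eq_rpow_re_of_pos (one_pos.trans_le (one_le_twoFloor x y u)), Complex.neg_re]

/-- **INTEGRABILITY** for `Re z > ½` (domination by `(AB)^{Re z}·max(1,‖u‖)^{−2Re z}`, ★ `integrable_max_one_normAbs_rpow_neg`). [cite: Casselman1980, §3] -/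
theorem integrable_twoFloor_cpow_mul_addChar {ψ : AddChar F Circle} (hψ : Continuous ψ) (x y η' : F) {z : ℂ} (hz : 1 / 2 < z.re) :
    Integrable (fun u : F =>
      ((max (max 1 ((normAbs F x : ℝ≥0) : ℝ)) ((normAbs F u : ℝ≥0) : ℝ) * max (max 1 ((normAbs F y : ℝ≥0) : ℝ)) ((normAbs F (u - x * y) : ℝ≥0) : ℝ) : ℝ) : ℂ) ^ (-z) *
        ((ψ (u * η') : Circle) : ℂ)) μ := by
  refine Integrable.mono' ((integrable_max_one_normAbs_rpow_neg μ (show (1 : ℝ) < 2 * z.re by linarith)).const_mul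
      ((max 1 ((normAbs F x : ℝ≥0) : ℝ) * max 1 ((normAbs F y : ℝ≥0) : ℝ)) ^ z.re))
    (continuous_twoFloor_cpow_mul_addChar hψ x y η' z).aestronglyMeasurable (Eventually.of_forall fun u => ?_)
  rw [norm_twoFloor_cpow_mul_addChar]
  exact twoFloor_rpow_neg_le x y u (by linarith)

/-- **HOLOMORPHY ON THE HALF-PLANE**: `z ↦ ∫ S(x,y;u)^{−z} ψ(uη′) dμ(u)` is holomorphic on `{½ < Re z}` (★ `differentiableOn_integral_of_dominated` with the majorant
`(AB)^{σ₁}·max(1,‖u‖)^{−2σ₀}`, `σ₀ = Re z₀ − R`, `σ₁ = Re z₀ + R`, `R = (Re z₀ − ½)∕2`, on the disc `B(z₀, R)`).  NOT claimed entire (the symbol is not radial, see the file header).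
[cite: GelbartPiatetskiShapiro1984, §4 (4.5)] [cite: Casselman1980, §3] -/
theorem differentiableOn_integral_twoFloor_cpow_mul_addChar {ψ : AddChar F Circle} (hψ : Continuous ψ) (x y η' : F) :
    DifferentiableOn ℂ (fun z : ℂ => ∫ u,
      ((max (max 1 ((normAbs F x : ℝ≥0) : ℝ)) ((normAbs F u : ℝ≥0) : ℝ) * max (max 1 ((normAbs F y : ℝ≥0) : ℝ)) ((normAbs F (u - x * y) : ℝ≥0) : ℝ) : ℝ) : ℂ) ^ (-z) *
        ((ψ (u * η') : Circle) : ℂ) ∂μ) {z : ℂ | 1 / 2 < z.re} := by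
  set AB : ℝ := max 1 ((normAbs F x : ℝ≥0) : ℝ) * max 1 ((normAbs F y : ℝ≥0) : ℝ) with hAB
  have hAB1 : 1 ≤ AB := one_le_mul_of_one_le_of_one_le (le_max_left _ _) (le_max_left _ _)
  refine Literature.Analysis.Complex.differentiableOn_integral_of_dominated
    (fun z _ => (continuous_twoFloor_cpow_mul_addChar hψ x y η' z).aestronglyMeasurable)
    (Eventually.of_forall fun u => ?_) fun z₀ hz₀ => ?_
  · have hc0 : ((max (max 1 ((normAbs F x : ℝ≥0) : ℝ)) ((normAbs F u : ℝ≥0) : ℝ) * max (max 1 ((normAbs F y : ℝ≥0) : ℝ)) ((normAbs F (u - x * y) : ℝ≥0) : ℝ) : ℝ) : ℂ) ≠ 0 := by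
      exact_mod_cast (one_pos.trans_le (one_le_twoFloor x y u)).ne'
    exact ((differentiable_id.neg.const_cpow (Or.inl hc0)).mul_const _).differentiableOn
  · have hz₀' : 1 / 2 < z₀.re := hz₀
    set R : ℝ := (z₀.re - 1 / 2) / 2 with hR
    have hR0 : 0 < R := by rw [hR]; linarith
    have hσ₀ : 1 / 2 < z₀.re - R := by rw [hR]; linarith
    refine ⟨R, hR0, fun z hz => ?_, fun u => AB ^ (z₀.re + R) * (max 1 ((normAbs F u : ℝ≥0) : ℝ)) ^ (-(2 * (z₀.re - R))),
      (integrable_max_one_normAbs_rpow_neg μ (show (1 : ℝ) < 2 * (z₀.re - R) by linarith)).const_mul _,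
      Eventually.of_forall fun u z hz => ?_⟩
    · have h1 : |z.re - z₀.re| ≤ ‖z - z₀‖ := by simpa [Complex.sub_re] using Complex.abs_re_le_norm (z - z₀)
      have h2 := abs_le.mp (h1.trans (mem_ball_iff_norm.mp hz).le)
      show 1 / 2 < z.re
      linarith [h2.1]
    · have h1 : |z.re - z₀.re| ≤ ‖z - z₀‖ := by simpa [Complex.sub_re] using Complex.abs_re_le_norm (z - z₀)
      have h2 := abs_le.mp (h1.trans (mem_ball_iff_norm.mp hz).le)
      have hlo : z₀.re - R ≤ z.re := by linarith [h2.1]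
      have hhi : z.re ≤ z₀.re + R := by linarith [h2.2]
      rw [norm_twoFloor_cpow_mul_addChar]
      have hM1 : (1 : ℝ) ≤ max 1 ((normAbs F u : ℝ≥0) : ℝ) := le_max_left _ _
      calc (max (max 1 ((normAbs F x : ℝ≥0) : ℝ)) ((normAbs F u : ℝ≥0) : ℝ) * max (max 1 ((normAbs F y : ℝ≥0) : ℝ)) ((normAbs F (u - x * y) : ℝ≥0) : ℝ)) ^ (-z.re)
          ≤ (max (max 1 ((normAbs F x : ℝ≥0) : ℝ)) ((normAbs F u : ℝ≥0) : ℝ) * max (max 1 ((normAbs F y : ℝ≥0) : ℝ)) ((normAbs F (u - x * y) : ℝ≥0) : ℝ)) ^ (-(z₀.re - R)) :=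
            Real.rpow_le_rpow_of_exponent_le (one_le_twoFloor x y u) (by linarith)
        _ ≤ AB ^ (z₀.re - R) * (max 1 ((normAbs F u : ℝ≥0) : ℝ)) ^ (-(2 * (z₀.re - R))) := twoFloor_rpow_neg_le x y u (by linarith)
        _ ≤ AB ^ (z₀.re + R) * (max 1 ((normAbs F u : ℝ≥0) : ℝ)) ^ (-(2 * (z₀.re - R))) :=
            mul_le_mul_of_nonneg_right (Real.rpow_le_rpow_of_exponent_le hAB1 (by linarith)) (Real.rpow_nonneg (zero_le_one.trans hM1) _)

/-! ## §6 The polynomial bound in the floors -/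

/-- **THE BOUND** (`Re z > ½`): `‖∫ S(x,y;u)^{−z} ψ(uη′) dμ‖ ≤ (A·B)^{Re z} · ∫ max(1,‖u‖)^{−2Re z} dμ` — polynomial in the floors `A = max(1,‖x‖)`, `B = max(1,‖y‖)`; the last integral is
★ `integral_max_one_normAbs_rpow_neg_two_mul` `= μ(𝒪)·(1 − q^{−2σ})∕(1 − q^{1−2σ})`.  (Not uniform in `(x,y)` on `½ < Re z < 1`, see the header.) [cite: Casselman1980, §3] -/
theorem norm_integral_twoFloor_cpow_mul_addChar_le (ψ : AddChar F Circle) (x y η' : F) {z : ℂ} (hz : 1 / 2 < z.re) :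
    ‖∫ u, ((max (max 1 ((normAbs F x : ℝ≥0) : ℝ)) ((normAbs F u : ℝ≥0) : ℝ) * max (max 1 ((normAbs F y : ℝ≥0) : ℝ)) ((normAbs F (u - x * y) : ℝ≥0) : ℝ) : ℝ) : ℂ) ^ (-z) *
        ((ψ (u * η') : Circle) : ℂ) ∂μ‖ ≤
      (max 1 ((normAbs F x : ℝ≥0) : ℝ) * max 1 ((normAbs F y : ℝ≥0) : ℝ)) ^ z.re * ∫ u, (max 1 ((normAbs F u : ℝ≥0) : ℝ)) ^ (-(2 * z.re)) ∂μ := by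
  rw [← integral_const_mul]
  refine norm_integral_le_of_norm_le ((integrable_max_one_normAbs_rpow_neg μ (show (1 : ℝ) < 2 * z.re by linarith)).const_mul _)
    (Eventually.of_forall fun u => ?_)
  rw [norm_twoFloor_cpow_mul_addChar]
  exact twoFloor_rpow_neg_le x y u (by linarith)

end Integrals

end Summit.HodgeConjecture.HodgeConjecture.Cruxes.H413.K2E1FourierJacobiLocalFiniteSplitU3

end
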